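import Summits.QuantumFields.BalabanUV.T4Continuum.Support.ShellMeasureRayWiring
import Summits.QuantumFields.BalabanUV.T4Continuum.Support.ShellMeasureWilsonBlock
import Summits.QuantumFields.BalabanUV.T4Continuum.Support.ShellMeasureLevelAssembly

/-!
# `T4Continuum.ShellMeasureWilsonSquare` — THE η-BOOKKEEPING OF END-II AT THE LIVE LEVELS (owner finding
# F-ne7cp1-g31-1 «END-II of record is SCALE-BLIND»): the letter-wise (SM) currency fails below an explicit `η*`,
# the STOKES currency is η-free, and the WILSON PLAQUETTE DENSITY AS AN ANALYTIC TERM WITH THE UNITARY SQUARE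
# STRUCTURE — `φ_p(w) = (β∕2N)·tr(E(w)·E(w̄)ᴴ)` — enters the one-depth engine through `hE` (S16), `P_w := ∅`
(cell `pub-balaban`, sub-cell `t4`, spine estimate NE7c (node U5b); owner lineage `b2b-balaban-t4-ne7c-p1`, gen 31,
row S72 of `t4/b2b-balaban-t4-ne7c-p1/LEAVES-NE7c-P1.md`; ADDITIVE — imports S16 `ShellMeasureRayWiring` (p208639:
`rayBound_of_analytic_terms`), `ShellMeasureWilsonBlock` (p205955: the matrix model `matrixTrace` in the scope
`Matrix.Norms.L2Operator`) and `ShellMeasureLevelAssembly` (p206468: the engine's `action`) ONLY; [folklore]; 1 DATA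
def (`wilsonSq`), 0 `def … : Prop`, 0 sorry, 0 citations)

HONEST FRAMING.  Finite four-torus programme, rung (B)+1 only — NOT infinite volume, NOT a mass gap, NOT the Clay
problem, NOT summit progress; (B), `BetaPertHyp`, (B^μ) not consumed.  NE7c (`T4IndicatorShell.ShellWeightBound`) is NOT
PRINTED in [Balaban 1983–89] and NOT PROVED; «NE7c ⇐ the named binders» (trigger c3).  Nothing printed is asserted
here; no estimate of Bałaban's is discharged; this file is complex-analytic ∕ matrix-algebra PLUMBING plus the
real arithmetic that makes the finding kernel-precise.

THE FINDING THIS FILE SERVES (GAPS F-ne7cp1-g31-1, owner gen 31 — an audit of OUR wiring, not of print; independent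
of the locality finding F-ne7cp1-g30-1).  END-II of record (`ShellMeasureLandauHolonomyPrint.slotAC_realized_su2_
landauChart_print` and every `…landauChart*` END) reads classifier AND weight through FINE-BOND LETTERS `ℓ(Z)` of one
exponent field (read-out norms `κ_r`, `κ_w`, field size `z̄′` on the complexified window).  A fine bond variable of the
minimiser is `η·A′(b)` (B11 (19), (22); `η_j = L^{−j}` at live level `j`), so `κ·z̄′ ∝ η_j`, while B14 (2.17)'s
classifier is a max over FINE plaquettes with threshold `θ_j = c·ε_j·η_j²` (`B14Radii`; GAPS G-ne7cp1-9).
(i) CLASSIFIER: END-II's (AN-bound) currency is LETTER-WISE, `H_AN = e^{m·κ_r z̄′} − 1 ≥ m·κ_r z̄′ ∝ η_j`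
(`ShellMeasureLandauHolonomyChart.hAN_of_consistentCurves` → `ShellMeasureLevelAssembly.classifierWitness_of_bondData`
→ `norm_wordExp_sub_one_le`), so `hSM : 36·(e^{m·κ_r z̄′} − 1)·1²∕(r_Φ∕S − 1)² ≤ δ·θ` reads `C·η_j ≤ C′·η_j²` (η-free
`C, C′`) and FAILS below an explicit `η*` (§1 `letterwise_hSM_fails`, END-II's LITERAL shape) — at every live level
once `K` is large.  The η²-correct STOKES currency `‖∏ e^{X_b} − 1‖ ≤ ‖Σ X_b‖ + expTail₂(Σ‖X_b‖)` (the letter sum is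
`η²·(DA)(p)`, B11 (25)∕(37)) EXISTS in the tree since gen 9 (`T4ShellMeasurePlaquette.norm_plaquetteFn_le_of_uniform`;
producer reading C-B11-G23a «H = (5∕2)B₅ε̄₁η² … the CANCELLATION of η² in (SM)») but is NOT wired into the LD chain;
with it `H ≤ η²·h` and (SM) is η-FREE (§1 `stokes_H_le`, `stokes_hSM`).
(ii) WEIGHT: the words budget `β·Σ_{p∈P_w} L̄_p(d̄_p + 4s̄_p)` (LD END: `L̄_p = m_w·3κ_w z̄′∕(Rad − 1)`, `s̄_p = m_wκ_w z̄′`,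
`d̄_p = 0`) is `∝ η_j²` per fine plaquette over `c_geo·η_j^{−4}` fine plaquettes of the block: EXACTLY `C″∕η_j²`
(§1 `wordsBudget_eq`), unbounded as `η_j → 0` (`wordsBudget_unbounded`).  The trace bound behind it is second order in
LETTER size (τ-cancellation); print's Wilson density is second order in the PLAQUETTE variable — unitarity,
`Re tr((U − 1)(U − 1)ᴴ) = 2N − 2·Re tr U` (§2 `re_trace_unitarySquare`) — whence `O(η⁴)` per fine plaquette and the
record's η-free ray cost `(LM₂R_j)⁴ε_j²g_j^{−2}`.  NO η-correct weight currency existed in the tree; §3–§4 supply it.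

WHAT IS PROVED ([folklore]; details in the declarations' docstrings).  §1 the arithmetic of the finding in END-II's
literal shapes (`letterwise_hSM_fails`, `stokes_H_le`, `stokes_hSM`, `wordsBudget_eq`, `wordsBudget_unbounded`,
`squareBudget_le`); §2 the unitary square structure in the cell's matrix model (`re_trace_unitarySquare`,
`norm_trace_le`); §3 the WILSON SQUARE TERM `wilsonSq β E w = (β∕2N)·tr(E(w)·E(w̄)ᴴ)` of a matrix curve (DATA):
holomorphic where `E` is (`differentiableOn_wilsonSq`, via Mathlib `DifferentiableAt.star_conj`), REAL on the real
ray and EQUAL there to the Wilson plaquette density `β·(1 − Re tr(1 + E c)∕N)` at unitary points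
(`wilsonSq_ofReal_re_of_unitary`), with oscillation `≤ |β|·H·O` from a sup bound `H` and an oscillation bound `O` of
the curve (`norm_wilsonSq_sub_le`; `H, O ∝ η²` in the Stokes currency ⇒ cost `∝ β·η⁴`; for a far plaquette `O` carries
the pin `e^{−δ′ϖ(p)}`, S70∕S71); §4 the JUNCTION `hE_of_wilsonSquares` = END-II's non-Wilson ray binder LITERALLY from
a finite family of such curves, by ONE CALL of S16 `rayBound_of_analytic_terms`, + non-vacuity; §5 `action_empty`:
with `P_w := ∅` the engine's action IS `𝓔`, so the live-level inhabitant of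
`ShellMeasureLevelAssembly.slotAntiConcentration_of_levelData` routes EVERY plaquette through `𝓔`∕`hE` and the words
currency `hGW` stays the LEVEL-0 currency (`η₀ = 1`; S19 untouched).
LOCATED INPUTS (displayed, NOT discharged, NOT asserted): the curves `E = hol_p − 1` along the complexified ray with
their Stokes-currency bounds (B11 Prop. 9 ∕ (19) ∕ (25) ∕ (37) TYPE; the CURL read-out norm `κ_c ∝ η²` is ONE MORE
displayed read-out binder of the W-a family), unitarity on the real ray (END-II's real structure (d)), the pin for
far plaquettes (F-g30-1's decay halves).  NOTHING in the countdown moves; NE7c NOT PROVED; spine PROVED 0∕9.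
HONEST DEPENDENCY (cell): continuum YM on T⁴ ⇐ BetaPertH ∧ nine spine estimates (0/9 proved); BetaPertH ⇐ (D1) ∧
(D4) ∧ CAP+tail; G-an2-4 gates asym, D1 and NE2/3/4.
-/

noncomputable section

open Metric Set Complex ComplexConjugate
open scoped Matrix

namespace Summit.QuantumFields.BalabanUV.T4Continuum.ShellMeasureWilsonSquare

open Literature.MathematicalPhysics.QuantumFieldTheory.Balaban1983to89
open T4ShellMeasurePlaquette (expTail₂ expTail₂_mono expTail₂_le_sq)
open Summit.QuantumFields.BalabanUV.T4Continuum.ShellMeasureRayWiring (rayBound_of_analytic_terms)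
open Summit.QuantumFields.BalabanUV.T4Continuum.ShellMeasureLevelAssembly (action)
open Summit.QuantumFields.BalabanUV.T4Continuum.ShellMeasureWilsonTrace (TraceData)

/-! ## §1 The arithmetic of the finding -/

section Arithmetic

/-- **THE LETTER-WISE (SM) CURRENCY FAILS BELOW AN EXPLICIT `η*`.**  In END-II's LITERAL `hSM` shape
`36·(e^{m·(κ·z)} − 1)·1²∕(Rad − 1)² ≤ δ·θ`, put the fine-bond read-out norm `κ = κ₀·η` and the fine-plaquette threshold
`θ = ε·η²` (B14 (2.17) TYPE); then for `0 < η < 36·m·κ₀·z∕((Rad − 1)²·δ·ε)` the inequality is FALSE (`e^t − 1 ≥ t`).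
All other quantities (`m, κ₀, z, Rad, δ, ε`) are η-free and positive; `1 < Rad`. [folklore] -/
theorem letterwise_hSM_fails {m κ₀ z Rad δ ε η : ℝ} (hRad : 1 < Rad) (hδ : 0 < δ) (hε : 0 < ε) (hη : 0 < η)
    (hsmall : η < 36 * m * κ₀ * z / ((Rad - 1) ^ 2 * δ * ε)) :
    ¬ 36 * (Real.exp (m * ((κ₀ * η) * z)) - 1) * 1 ^ 2 / (Rad - 1) ^ 2 ≤ δ * (ε * η ^ 2) := by
  intro h
  have hR1 : 0 < (Rad - 1) ^ 2 := by positivity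
  have hexp : m * ((κ₀ * η) * z) ≤ Real.exp (m * ((κ₀ * η) * z)) - 1 := by
    linarith [Real.add_one_le_exp (m * ((κ₀ * η) * z))]
  have h1 : 36 * (m * ((κ₀ * η) * z)) / (Rad - 1) ^ 2 ≤ δ * (ε * η ^ 2) := by
    refine le_trans ?_ h
    rw [one_pow, mul_one]
    exact div_le_div_of_nonneg_right (by nlinarith) hR1.le
  rw [div_le_iff₀ hR1] at h1
  -- divide by `η > 0`: `36 m κ₀ z ≤ δ ε η (Rad − 1)²`, contradicting `hsmall`
  have h2 : 36 * m * κ₀ * z ≤ η * ((Rad - 1) ^ 2 * δ * ε) := by nlinarith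
  have hpos : 0 < (Rad - 1) ^ 2 * δ * ε := by positivity
  rw [lt_div_iff₀ hpos] at hsmall
  linarith

/-- **THE STOKES CURRENCY IS `∝ η²`.**  With the CURL read-out bound `s₁ ≤ c₁·η²·z` (the letter SUM, B11 (25)∕(37)
TYPE), per-letter bounds `a ≤ c₂·η·z` ((19) TYPE), `m` letters and the regime `m·a ≤ 1`, the plaquette inheritance
bound `H = s₁ + expTail₂(m·a)` (`T4ShellMeasurePlaquette.norm_plaquetteFn_le_of_uniform`) satisfies
`H ≤ η²·(c₁·z + m²·c₂²·z²)`. [folklore] -/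
theorem stokes_H_le {s₁ a c₁ c₂ z η : ℝ} {m : ℕ}
    (ha0 : 0 ≤ a) (hs₁ : s₁ ≤ c₁ * η ^ 2 * z) (ha : a ≤ c₂ * η * z) (hma : m * a ≤ 1) :
    s₁ + expTail₂ (m * a) ≤ η ^ 2 * (c₁ * z + m ^ 2 * c₂ ^ 2 * z ^ 2) := by
  have hma0 : 0 ≤ (m : ℝ) * a := by positivity
  have ht : expTail₂ (m * a) ≤ (m * a) ^ 2 := expTail₂_le_sq (by rw [abs_of_nonneg hma0]; exact hma)
  have h2 : (m * a) ^ 2 ≤ (m * (c₂ * η * z)) ^ 2 := by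
    have : (m : ℝ) * a ≤ m * (c₂ * η * z) := mul_le_mul_of_nonneg_left ha (Nat.cast_nonneg m)
    exact pow_le_pow_left₀ hma0 this 2
  have h3 : (m * (c₂ * η * z)) ^ 2 = η ^ 2 * (m ^ 2 * c₂ ^ 2 * z ^ 2) := by ring
  have h4 : η ^ 2 * (c₁ * z + m ^ 2 * c₂ ^ 2 * z ^ 2) = c₁ * η ^ 2 * z + η ^ 2 * (m ^ 2 * c₂ ^ 2 * z ^ 2) := by
    ring
  rw [h4]
  linarith

/-- **(SM) IN THE STOKES CURRENCY IS η-FREE**: the unit-currency smallness `36·h∕(Rad − 1)² ≤ δ·ε` gives END-II's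
`hSM` LITERALLY at the fine-currency pair `(H, θ) = (η²·h′, ε·η²)` for every `h′ ≤ h` — the η² CANCELS
(C-B11-G23a). [folklore] -/
theorem stokes_hSM {H h Rad δ ε η : ℝ} (hRad : 1 < Rad) (hη : 0 < η) (hH : H ≤ η ^ 2 * h)
    (hsm : 36 * h / (Rad - 1) ^ 2 ≤ δ * ε) :
    36 * H * 1 ^ 2 / (Rad - 1) ^ 2 ≤ δ * (ε * η ^ 2) := by
  have hR1 : 0 < (Rad - 1) ^ 2 := by positivity
  have hη2 : 0 < η ^ 2 := by positivity
  rw [one_pow, mul_one]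
  calc 36 * H / (Rad - 1) ^ 2 ≤ 36 * (η ^ 2 * h) / (Rad - 1) ^ 2 :=
        div_le_div_of_nonneg_right (by linarith) hR1.le
    _ = η ^ 2 * (36 * h / (Rad - 1) ^ 2) := by ring
    _ ≤ η ^ 2 * (δ * ε) := mul_le_mul_of_nonneg_left hsm hη2.le
    _ = δ * (ε * η ^ 2) := by ring

/-- **THE WORDS BUDGET OF THE BLOCK IS EXACTLY `C∕η²`.**  With `c_geo∕η⁴` fine plaquettes in the block, the LD END's
uniform letter data `L̄ = m·3·(κ₀η)·z∕(Rad − 1)`, `s̄ = m·(κ₀η)·z`, `d̄ = 0`, the block part of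
`β·Σ_p L̄_p(d̄_p + 4s̄_p)` equals `(12·c_geo·β·m²·κ₀²·z²∕(Rad − 1))∕η²`. [folklore] -/
theorem wordsBudget_eq {cgeo β m κ₀ z Rad η : ℝ} (hη : η ≠ 0) (hRad : Rad - 1 ≠ 0) :
    cgeo / η ^ 4 * (β * (m * (3 * ((κ₀ * η) * z) / (Rad - 1)) * (0 + 4 * (m * ((κ₀ * η) * z))))) =
      12 * cgeo * β * m ^ 2 * κ₀ ^ 2 * z ^ 2 / (Rad - 1) / η ^ 2 := by
  field_simp
  ring

/-- … hence UNBOUNDED as `η → 0⁺`: for every bound `B` there is an `η₀ > 0` below which the block part exceeds `B`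
(all constants positive). [folklore] -/
theorem wordsBudget_unbounded {cgeo β m κ₀ z Rad : ℝ} (hc : 0 < cgeo) (hβ : 0 < β) (hm : 0 < m) (hκ : 0 < κ₀)
    (hz : 0 < z) (hRad : 1 < Rad) (B : ℝ) :
    ∃ η₀ : ℝ, 0 < η₀ ∧ ∀ η : ℝ, 0 < η → η < η₀ →
      B < cgeo / η ^ 4 * (β * (m * (3 * ((κ₀ * η) * z) / (Rad - 1)) * (0 + 4 * (m * ((κ₀ * η) * z))))) := by
  set C := 12 * cgeo * β * m ^ 2 * κ₀ ^ 2 * z ^ 2 / (Rad - 1) with hC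
  have hR1 : 0 < Rad - 1 := by linarith
  have hCpos : 0 < C := by rw [hC]; positivity
  -- choose η₀ with η₀² ≤ C / (|B| + 1), e.g. η₀ = min 1 (C / (|B| + 1))
  refine ⟨min 1 (C / (|B| + 1)), lt_min one_pos (by positivity), fun η hη hηlt => ?_⟩
  rw [wordsBudget_eq hη.ne' hR1.ne', ← hC]
  have hη1 : η < 1 := lt_of_lt_of_le hηlt (min_le_left _ _)
  have hηC : η < C / (|B| + 1) := lt_of_lt_of_le hηlt (min_le_right _ _)
  have hB1 : 0 < |B| + 1 := by positivity
  have hη2 : η ^ 2 ≤ η := by nlinarith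
  have hη2pos : 0 < η ^ 2 := by positivity
  -- `C / η² ≥ C / η > |B| + 1 > B`
  have h1 : (|B| + 1) * η < C := by have h := (lt_div_iff₀ hB1).1 hηC; linarith
  have h2 : (|B| + 1) * η ^ 2 < C := lt_of_le_of_lt (by nlinarith) h1
  rw [lt_div_iff₀ hη2pos]
  have hB : B ≤ |B| := le_abs_self B
  nlinarith

/-- **THE SQUARE-TERM BUDGET OF THE BLOCK IS η-FREE.**  If the block carries at most `c_geo∕η⁴` plaquettes and each
§3 term costs `β·H_p·O_p` with Stokes-currency data `H_p ≤ η²·h`, `O_p ≤ η²·o` (nonnegative), then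
`Σ_p β·H_p·O_p ≤ c_geo·β·h·o` — NO `η`. [folklore] -/
theorem squareBudget_le {ι : Type*} (P : Finset ι) {H O : ι → ℝ} {cgeo β h o η : ℝ} (hη : 0 < η) (hβ : 0 ≤ β)
    (hh : 0 ≤ h) (ho : 0 ≤ o) (hcard : (P.card : ℝ) ≤ cgeo / η ^ 4)
    (hH0 : ∀ p ∈ P, 0 ≤ H p) (hH : ∀ p ∈ P, H p ≤ η ^ 2 * h) (hO0 : ∀ p ∈ P, 0 ≤ O p)
    (hO : ∀ p ∈ P, O p ≤ η ^ 2 * o) :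
    ∑ p ∈ P, β * H p * O p ≤ cgeo * β * h * o := by
  have hη4 : 0 < η ^ 4 := by positivity
  calc ∑ p ∈ P, β * H p * O p ≤ ∑ _p ∈ P, β * (η ^ 2 * h) * (η ^ 2 * o) :=
        Finset.sum_le_sum fun p hp => mul_le_mul (mul_le_mul_of_nonneg_left (hH p hp) hβ) (hO p hp) (hO0 p hp)
          (mul_nonneg hβ (by nlinarith [hH0 p hp, hH p hp]))
    _ = P.card * (η ^ 4 * (β * h * o)) := by rw [Finset.sum_const, nsmul_eq_mul]; ring
    _ ≤ cgeo / η ^ 4 * (η ^ 4 * (β * h * o)) := mul_le_mul_of_nonneg_right hcard (by positivity)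
    _ = cgeo * β * h * o := by field_simp

end Arithmetic

/-! ## §2 The unitary square structure in the matrix model -/

section MatrixModel
open scoped Matrix.Norms.L2Operator
variable {n : Type*} [Fintype n]

/-- `Re tr(M·Mᴴ) = Σ_ab ‖M_ab‖²`. [folklore] -/
theorem re_trace_mul_conjTranspose_self (M : Matrix n n ℂ) :
    (Matrix.trace (M * Mᴴ)).re = ∑ a, ∑ b, ‖M a b‖ ^ 2 := by
  simp only [Matrix.trace, Matrix.diag_apply, Matrix.mul_apply, Matrix.conjTranspose_apply, Complex.re_sum,
    RCLike.star_def, Complex.mul_conj, Complex.ofReal_re, Complex.normSq_eq_norm_sq]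

/-- `tr(M·Mᴴ)` is real. [folklore] -/
theorem im_trace_mul_conjTranspose_self (M : Matrix n n ℂ) : (Matrix.trace (M * Mᴴ)).im = 0 := by
  simp only [Matrix.trace, Matrix.diag_apply, Matrix.mul_apply, Matrix.conjTranspose_apply, Complex.im_sum,
    RCLike.star_def, Complex.mul_conj, Complex.ofReal_im, Finset.sum_const_zero]

/-! ## §2b The Wilson square term of a matrix curve (no norm needed) -/

/-- THE WILSON SQUARE TERM of a matrix curve `E : ℂ → M_N(ℂ)` at inverse coupling `β` (DATA):
`wilsonSq β E w = (β∕2N)·tr(E(w)·E(w̄)ᴴ)` — the holomorphic function of the ray parameter that restricts on the real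
ray to `(β∕2N)·‖E(c)‖²_F`, i.e. to `β·(1 − Re tr(1 + E c)∕N)` when `1 + E(c)` is unitary. [folklore] -/
def wilsonSq (β : ℝ) (E : ℂ → Matrix n n ℂ) : ℂ → ℂ :=
  fun w => ((β / (2 * Fintype.card n) : ℝ) : ℂ) * Matrix.trace (E w * (E (conj w))ᴴ)

/-- Unfolding. [folklore] -/
theorem wilsonSq_apply (β : ℝ) (E : ℂ → Matrix n n ℂ) (w : ℂ) :
    wilsonSq β E w = ((β / (2 * Fintype.card n) : ℝ) : ℂ) * Matrix.trace (E w * (E (conj w))ᴴ) := rfl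

/-- On the real ray the reflection is invisible: `wilsonSq β E c = (β∕2N)·tr(E(c)·E(c)ᴴ)`. [folklore] -/
theorem wilsonSq_ofReal (β : ℝ) (E : ℂ → Matrix n n ℂ) (c : ℝ) :
    wilsonSq β E c = ((β / (2 * Fintype.card n) : ℝ) : ℂ) * Matrix.trace (E c * (E c)ᴴ) := by
  rw [wilsonSq_apply, Complex.conj_ofReal]

/-- … so it is REAL there. [folklore] -/
theorem wilsonSq_ofReal_im (β : ℝ) (E : ℂ → Matrix n n ℂ) (c : ℝ) : (wilsonSq β E c).im = 0 := by
  rw [wilsonSq_ofReal, Complex.im_ofReal_mul, im_trace_mul_conjTranspose_self, mul_zero]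

/-- … with real part `(β∕2N)·Re tr(E(c)E(c)ᴴ) = (β∕2N)·Σ_ab ‖E(c)_ab‖²`. [folklore] -/
theorem wilsonSq_ofReal_re (β : ℝ) (E : ℂ → Matrix n n ℂ) (c : ℝ) :
    (wilsonSq β E c).re = β / (2 * Fintype.card n) * (Matrix.trace (E c * (E c)ᴴ)).re := by
  rw [wilsonSq_ofReal, Complex.re_ofReal_mul]

/-! ## §3 Unitarity, holomorphy, oscillation (operator norm) -/

variable [DecidableEq n]

/-- **UNITARITY: `Re tr((U − 1)(U − 1)ᴴ) = 2N − 2·Re tr U`** for `U·Uᴴ = 1` — the Wilson plaquette density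
`N − Re tr U` is HALF THE FROBENIUS SQUARE of the plaquette variable `U − 1`, i.e. SECOND ORDER in it. [folklore] -/
theorem re_trace_unitarySquare {U : Matrix n n ℂ} (hU : U * Uᴴ = 1) :
    (Matrix.trace ((U - 1) * (U - 1)ᴴ)).re = 2 * Fintype.card n - 2 * (Matrix.trace U).re := by
  have hexp : (U - 1) * (U - 1)ᴴ = U * Uᴴ - Uᴴ - U + 1 := by
    rw [Matrix.conjTranspose_sub, Matrix.conjTranspose_one]; noncomm_ring
  rw [hexp, hU, Matrix.trace_add, Matrix.trace_sub, Matrix.trace_sub, Matrix.trace_one,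
    Matrix.trace_conjTranspose, Complex.add_re, Complex.sub_re, Complex.sub_re, RCLike.star_def, Complex.conj_re,
    Complex.natCast_re]
  ring

open Literature.Computability.QuantumComplexity.SolovayKitaev (norm_apply_le_norm) in
/-- `‖tr M‖ ≤ N·‖M‖` in the operator norm (diagonal entries are bounded by the norm). [folklore] -/
theorem norm_trace_le (M : Matrix n n ℂ) : ‖Matrix.trace M‖ ≤ Fintype.card n * ‖M‖ := by
  calc ‖Matrix.trace M‖ = ‖∑ i, M i i‖ := by simp [Matrix.trace]
    _ ≤ ∑ i, ‖M i i‖ := norm_sum_le _ _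
    _ ≤ ∑ _i : n, ‖M‖ := Finset.sum_le_sum fun i _ => norm_apply_le_norm _ i i
    _ = Fintype.card n * ‖M‖ := by simp

/-- the reflected conjugate-transpose `w ↦ (E w̄)ᴴ` of a holomorphic matrix curve is holomorphic on any ball about `0`
(Mathlib `DifferentiableAt.star_conj`; the ball is invariant under `w ↦ w̄`). [folklore] -/
theorem differentiableOn_reflStar {E : ℂ → Matrix n n ℂ} {R : ℝ} (hE : DifferentiableOn ℂ E (ball 0 R)) :
    DifferentiableOn ℂ (fun w => (E (conj w))ᴴ) (ball 0 R) := by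
  intro w hw
  have hw' : conj w ∈ ball (0 : ℂ) R := by simpa [mem_ball_zero_iff, Complex.norm_conj] using hw
  have hd : DifferentiableAt ℂ E (conj w) := hE.differentiableAt (isOpen_ball.mem_nhds hw')
  have h := hd.star_conj
  rw [Complex.conj_conj] at h
  have e : (star ∘ E ∘ conj : ℂ → Matrix n n ℂ) = fun w => (E (conj w))ᴴ := by
    funext v; simp [Function.comp, Matrix.star_eq_conjTranspose]
  rw [e] at h
  exact h.differentiableWithinAt

/-- **THE WILSON SQUARE TERM IS HOLOMORPHIC** on any ball about `0` on which the curve is. [folklore] -/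
theorem differentiableOn_wilsonSq (β : ℝ) {E : ℂ → Matrix n n ℂ} {R : ℝ} (hE : DifferentiableOn ℂ E (ball 0 R)) :
    DifferentiableOn ℂ (wilsonSq β E) (ball 0 R) := by
  have htr : Differentiable ℂ fun M : Matrix n n ℂ => Matrix.trace M := by
    have e : (fun M : Matrix n n ℂ => Matrix.trace M) =
        ⇑(LinearMap.toContinuousLinearMap (Matrix.traceLinearMap n ℂ ℂ)) := by
      funext M; rfl
    rw [e]
    exact (LinearMap.toContinuousLinearMap (Matrix.traceLinearMap n ℂ ℂ)).differentiable
  have hprod : DifferentiableOn ℂ (fun w => E w * (E (conj w))ᴴ) (ball 0 R) := hE.mul (differentiableOn_reflStar hE)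
  have hcomp : DifferentiableOn ℂ (fun w => Matrix.trace (E w * (E (conj w))ᴴ)) (ball 0 R) :=
    htr.comp_differentiableOn hprod
  exact (differentiableOn_const _).mul hcomp

/-- **ON THE REAL RAY, AT A UNITARY POINT, THE SQUARE TERM IS THE WILSON PLAQUETTE DENSITY**: if `1 + E(c)` is unitary
then `Re (wilsonSq β E c) = β·(1 − Re tr(1 + E c)∕N)` (`N = card n > 0`). [folklore] -/
theorem wilsonSq_ofReal_re_of_unitary [Nonempty n] (β : ℝ) {E : ℂ → Matrix n n ℂ} {c : ℝ}
    (hU : (1 + E c) * (1 + E c)ᴴ = 1) :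
    (wilsonSq β E c).re = β * (1 - (Matrix.trace (1 + E (c : ℂ))).re / Fintype.card n) := by
  have hN : (0 : ℝ) < Fintype.card n := Nat.cast_pos.mpr Fintype.card_pos
  have hsq := re_trace_unitarySquare hU
  rw [add_sub_cancel_left] at hsq
  rw [wilsonSq_ofReal_re, hsq]
  field_simp

/-- **THE OSCILLATION OF THE SQUARE TERM**: a sup bound `‖E w‖ ≤ H` and an oscillation bound `‖E w − E 0‖ ≤ O` on the
ball give `‖wilsonSq β E w − wilsonSq β E 0‖ ≤ |β|·H·O` there (`tr(AB̄ᴴ) − tr(A₀Ā₀ᴴ) = tr((A − A₀)B̄ᴴ) + tr(A₀(B̄ − Ā₀)ᴴ)`,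
`‖tr M‖ ≤ N‖M‖`, `‖Mᴴ‖ = ‖M‖`).  In the Stokes currency `H, O ∝ η²`, so the cost is `∝ β·η⁴`. [folklore] -/
theorem norm_wilsonSq_sub_le (β : ℝ) {E : ℂ → Matrix n n ℂ} {R H O : ℝ}
    (hH : ∀ w ∈ ball (0 : ℂ) R, ‖E w‖ ≤ H) (hO : ∀ w ∈ ball (0 : ℂ) R, ‖E w - E 0‖ ≤ O) :
    ∀ w ∈ ball (0 : ℂ) R, ‖wilsonSq β E w - wilsonSq β E 0‖ ≤ |β| * H * O := by
  intro w hw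
  have hR : 0 < R := (norm_nonneg w).trans_lt (mem_ball_zero_iff.1 hw)
  have h0 : (0 : ℂ) ∈ ball (0 : ℂ) R := mem_ball_self hR
  have hw' : conj w ∈ ball (0 : ℂ) R := by simpa [mem_ball_zero_iff, Complex.norm_conj] using hw
  have hH0 : 0 ≤ H := (norm_nonneg _).trans (hH 0 h0)
  have hO0 : 0 ≤ O := by simpa using hO 0 h0
  rcases isEmpty_or_nonempty n with hn | hn
  · -- no entries: every trace vanishes
    have : ∀ M : Matrix n n ℂ, Matrix.trace M = 0 := fun M => by simp [Matrix.trace]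
    simp only [wilsonSq_apply, this, mul_zero, sub_self, norm_zero]
    exact mul_nonneg (mul_nonneg (abs_nonneg _) hH0) hO0
  have hN : (0 : ℝ) < Fintype.card n := Nat.cast_pos.mpr Fintype.card_pos
  -- the algebra
  have key : E w * (E (conj w))ᴴ - E 0 * (E (conj 0))ᴴ =
      (E w - E 0) * (E (conj w))ᴴ + E 0 * (E (conj w) - E 0)ᴴ := by
    rw [map_zero, Matrix.conjTranspose_sub]; noncomm_ring
  have e : wilsonSq β E w - wilsonSq β E 0 =
      ((β / (2 * Fintype.card n) : ℝ) : ℂ) * Matrix.trace ((E w - E 0) * (E (conj w))ᴴ + E 0 * (E (conj w) - E 0)ᴴ) := by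
    rw [wilsonSq_apply, wilsonSq_apply, ← mul_sub, ← Matrix.trace_sub, key]
  rw [e, norm_mul, Complex.norm_real, Real.norm_eq_abs, Matrix.trace_add]
  have t1 : ‖Matrix.trace ((E w - E 0) * (E (conj w))ᴴ)‖ ≤ Fintype.card n * (O * H) := by
    refine (norm_trace_le _).trans (mul_le_mul_of_nonneg_left ?_ hN.le)
    refine (norm_mul_le _ _).trans ?_
    rw [Matrix.l2_opNorm_conjTranspose]
    exact mul_le_mul (hO w hw) (hH _ hw') (norm_nonneg _) hO0
  have t2 : ‖Matrix.trace (E 0 * (E (conj w) - E 0)ᴴ)‖ ≤ Fintype.card n * (H * O) := by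
    refine (norm_trace_le _).trans (mul_le_mul_of_nonneg_left ?_ hN.le)
    refine (norm_mul_le _ _).trans ?_
    rw [Matrix.l2_opNorm_conjTranspose]
    exact mul_le_mul (hH 0 h0) (hO _ hw') (norm_nonneg _) hH0
  have habs : |β / (2 * Fintype.card n)| = |β| / (2 * Fintype.card n) := by
    rw [abs_div, abs_of_pos (mul_pos two_pos hN)]
  rw [habs]
  calc |β| / (2 * Fintype.card n) * ‖Matrix.trace ((E w - E 0) * (E (conj w))ᴴ) +
          Matrix.trace (E 0 * (E (conj w) - E 0)ᴴ)‖
      ≤ |β| / (2 * Fintype.card n) * (Fintype.card n * (O * H) + Fintype.card n * (H * O)) := by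
        refine mul_le_mul_of_nonneg_left ((norm_add_le _ _).trans (add_le_add t1 t2)) (by positivity)
    _ = |β| * H * O := by field_simp; ring

/-! ## §4 The junction: END-II's `hE` from the Wilson square terms, by S16 -/

section Junction
variable {E𝔠 : Type*} [AddCommGroup E𝔠] [Module ℝ E𝔠]

/-- **END-II's NON-WILSON RAY BINDER FROM THE WILSON SQUARE TERMS** (one call of S16
`ShellMeasureRayWiring.rayBound_of_analytic_terms`).  Per window point `x ∈ W` a finite plaquette set `P x` and matrix
curves `E x p : ℂ → M_N(ℂ)` (the plaquette variables `hol_p − 1` along the complexified chart ray — located, NOT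
instantiated), holomorphic on `‖w‖ < R` (`R > 1`) with sup bounds `H x p`, oscillation bounds `O x p`, budget
`Σ_p |β|·H x p·O x p ≤ H̄`, UNITARY on the real segment (`(1 + E x p c)(1 + E x p c)ᴴ = 1`, the real structure), and a
ray profile `𝓔` whose value at `c • x` IS the sectioned Wilson action `Σ_p β·(1 − Re tr(1 + E x p c)∕N)` (dictionary).
CONCLUSION: `∀ x ∈ W, ∀ c, 1∕2 ≤ c → c ≤ 1 → 𝓔 (c • x) ≤ 𝓔 x + (1 − c)·(3H̄∕(R − 1))` — END-II's `hE` LITERALLY, with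
an η-FREE `H̄` once the data are in the Stokes currency (§1 `squareBudget_le`). [folklore] -/
theorem hE_of_wilsonSquares [Nonempty n] {W : Set E𝔠} {ι : Type*} (P : E𝔠 → Finset ι)
    (E : E𝔠 → ι → ℂ → Matrix n n ℂ) {R β Hbar : ℝ} {H O : E𝔠 → ι → ℝ} (hR : 1 < R)
    (hEd : ∀ x ∈ W, ∀ p ∈ P x, DifferentiableOn ℂ (E x p) (ball 0 R))
    (hH : ∀ x ∈ W, ∀ p ∈ P x, ∀ w ∈ ball (0 : ℂ) R, ‖E x p w‖ ≤ H x p)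
    (hO : ∀ x ∈ W, ∀ p ∈ P x, ∀ w ∈ ball (0 : ℂ) R, ‖E x p w - E x p 0‖ ≤ O x p)
    (hsum : ∀ x ∈ W, ∑ p ∈ P x, |β| * H x p * O x p ≤ Hbar)
    (hunit : ∀ x ∈ W, ∀ p ∈ P x, ∀ c : ℝ, 0 ≤ c → c ≤ 1 → (1 + E x p c) * (1 + E x p c)ᴴ = 1)
    {𝓔 : E𝔠 → ℝ}
    (hdict : ∀ x ∈ W, ∀ c : ℝ, 0 ≤ c → c ≤ 1 →
      𝓔 (c • x) = ∑ p ∈ P x, β * (1 - (Matrix.trace (1 + E x p (c : ℂ))).re / Fintype.card n)) :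
    ∀ x ∈ W, ∀ c : ℝ, 1 / 2 ≤ c → c ≤ 1 → 𝓔 (c • x) ≤ 𝓔 x + (1 - c) * (3 * Hbar / (R - 1)) := by
  refine rayBound_of_analytic_terms P (g := fun x p => wilsonSq β (E x p)) (H := fun x p => |β| * H x p * O x p)
    hR (fun x hx p hp => differentiableOn_wilsonSq β (hEd x hx p hp))
    (fun x hx p hp => norm_wilsonSq_sub_le β (hH x hx p hp) (hO x hx p hp)) hsum fun x hx c hc0 hc1 => ?_
  rw [hdict x hx c hc0 hc1, Complex.re_sum]
  exact Finset.sum_congr rfl fun p hp => wilsonSq_ofReal_re_of_unitary β (hunit x hx p hp c hc0 hc1)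

/-- NON-VACUITY of the junction's binder shapes (trigger c3): the FLAT toy on `M_1(ℂ)` — one plaquette per window
point with the constant curve `E ≡ 0` (unitary: `1·1ᴴ = 1`), `H = O = H̄ = 0`, radius `2`, ray profile `𝓔 ≡ 0`; every
hypothesis is met and the conclusion is the (true) inequality `0 ≤ 0 + (1 − c)·0`. [folklore] -/
example : ∀ x ∈ (univ : Set ℝ), ∀ c : ℝ, 1 / 2 ≤ c → c ≤ 1 →
    (fun _ : ℝ => (0 : ℝ)) (c • x) ≤ (fun _ : ℝ => (0 : ℝ)) x + (1 - c) * (3 * 0 / (2 - 1)) :=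
  hE_of_wilsonSquares (n := Fin 1) (W := univ) (fun _ => ({()} : Finset Unit))
    (fun _ _ _ => (0 : Matrix (Fin 1) (Fin 1) ℂ)) (R := 2) (β := 1) (Hbar := 0) (H := fun _ _ => 0)
    (O := fun _ _ => 0) (by norm_num) (fun _ _ _ _ => differentiableOn_const _) (by simp) (by simp) (by simp)
    (by intros; simp) (𝓔 := fun _ : ℝ => (0 : ℝ)) (by intros; simp)

end Junction
end MatrixModel

/-! ## §5 The inhabitant's reading of `ShellMeasureLevelAssembly`: Wilson part through `𝓔`, `P_w := ∅` -/

section Reading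
variable {E𝔠 : Type*} {A : Type*} [NormedRing A] [NormedAlgebra ℂ A]

/-- **WITH `P_w := ∅` THE ENGINE'S ACTION IS ITS NON-WILSON TERM**: `action T β ∅ G 𝓔 = 𝓔` — so an inhabitant of
`ShellMeasureLevelAssembly.slotAntiConcentration_of_levelData` at a live level who puts the WHOLE sectioned Wilson
action (near plaquettes with flat data, far plaquettes with pinned data) into `𝓔`, with `hE` from
`hE_of_wilsonSquares` (+ S71 `ShellMeasureRayTermsPinned.hE_of_pinned_terms` for the genuine non-Wilson terms), meets
the engine's weight `e^{−action}` VERBATIM and its slot constant `2(dim E + (β·0 + B_𝓔))∕(1 − δ)` carries NO words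
budget. [folklore] -/
theorem action_empty (T : TraceData A) (β : ℝ) {κ : Type*} (G : κ → E𝔠 → A) (𝓔 : E𝔠 → ℝ) :
    action T β (∅ : Finset κ) G 𝓔 = 𝓔 := by
  funext x
  simp [action]

end Reading
end Summit.QuantumFields.BalabanUV.T4Continuum.ShellMeasureWilsonSquare

end
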